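import Literature.NumberTheory.ComplexMultiplication.CMTypeRankCommonConstituent
import Literature.NumberTheory.ComplexMultiplication.CMTypeRankTypeConjugation
import HarnessLib

/-!
# Rank COLLAPSE for a two-slot family of CM types through an equivariant map between the slots

COR-CM (cell `pub-hodgecm2`, binder seat `b16` gen 45, count-neutral claim REFLEX-OCTIC-34, file F2); theorems only, no
definition, no named fact, no `sorry`.  Abstract setting of `Literature/NumberTheory/ComplexMultiplication/CMTypeRankFamilies`
(a group `G` acting slot by slot on `⊔_i E_i`, a commuting conjugation `ρ`, CM types `Φ_i ⊆ E_i`, the family type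
`Σ = sigmaType Φ`, Shimura's antisymmetric spans `U(Φ_i) = antiSpan G (Φ_i) = span{u_g(Φ_i)}`, `U(Σ)`, `rank = dim U + 1`)
for a TWO-slot family `{i₀, i₁}`.

> **Theorem** (`finrank_antiSpan_sigmaType_eq_of_equivariant`).  Suppose some `G`-equivariant linear map
> `L : ℚ^{E_{i₁}} → ℚ^{E_{i₀}}` sends the sign vector `u_1(Φ_{i₁}) = 𝟙_{Φ_{i₁}} − 𝟙_{Φ̄_{i₁}}` to a NON-ZERO multiple
> `c · u_1(Φ_{i₀})` of the sign vector of `Φ_{i₀}`.  Then `dim U(Σ) = dim U(Φ_{i₁})`: `rank(Σ) = rank(Φ_{i₁})`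
> (`typeRank_sigmaType_eq_of_equivariant`), so the family is DEGENERATE as soon as `E_{i₀} ≠ ∅`
> (`typeRank_sigmaType_lt_of_equivariant`) — on Hodge groups, `Hg(A_{i₀} × A_{i₁}) → Hg(A_{i₁})` is an isogeny.

PROOF.  By equivariance `L(u_g(Φ_{i₁})) = L(u_1(Φ_{i₁}) ∘ g) = c · u_1(Φ_{i₀}) ∘ g = c · u_g(Φ_{i₀})`, so on the
generators `u_g(Σ) = (u_g(Φ_{i₀}) ; u_g(Φ_{i₁}))` of `U(Σ)`, and hence on all of `U(Σ)`, the `i₀`-restriction is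
`c⁻¹ L ∘` (the `i₁`-restriction).  The `i₁`-restriction is therefore injective on `U(Σ)`; its image is `U(Φ_{i₁})`
(`map_funLeft_mk_antiSpan_sigmaType`).

This generalises the rank collapse of `CMTypeRankQuadraticTowerDegenerate` (there `L` is the fibre sum of a quadratic
tower and `c = 2`) and is used for a CM field with pair flips against its REFLEX field (`PairFlipSexticReflexSlotRank`:
`L` is the transpose of the reflex incidence, `(L f)(z) = Σ_{y : z ∈ T y} f(y)`).  §2 records that such INCIDENCE SUMS of a
`G`-invariant relation are equivariant (`incidenceSum_comp_smul`).

## References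

* [Gordon1999HodgeAVSurvey] B. B. Gordon, *A survey of the Hodge conjecture for abelian varieties*, §3 Theorem (proof),
  7.5–7.7 (`rank Hg(A × B) < rank Hg(A) + rank Hg(B)`: exceptional classes on products).
* [Deligne1982HodgeCycles] P. Deligne, *Hodge cycles on abelian varieties*, LNM 900, I Ex. 3.7 (c).
* [Shimura1998] G. Shimura, *Abelian Varieties with Complex Multiplication and Modular Functions*, §32.10.
-/

set_option autoImplicit false

noncomputable section

open scoped BigOperators

namespace Summit.HodgeConjecture.CorCM

namespace ReflexSlot

open Literature.NumberTheory.ComplexMultiplication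

variable {G : Type*} [Group G] {I : Type*} {E : I → Type*} [∀ i, MulAction G (E i)] [∀ i, Fintype (E i)]
  {ρ : G} {Φ : ∀ i, Set (E i)} {i₀ i₁ : I}

/-! ### §1 The collapse -/

omit [∀ i, Fintype (E i)] in
/-- **Rank collapse through an equivariant map.**  If a `G`-equivariant linear `L : ℚ^{E_{i₁}} → ℚ^{E_{i₀}}` sends
`u_1(Φ_{i₁})` to `c · u_1(Φ_{i₀})` with `c ≠ 0`, then `dim U(Σ) = dim U(Φ_{i₁})` for the two-slot family `Σ`.
[cite: Gordon1999HodgeAVSurvey, §3 Theorem (proof) and 7.5–7.7] -/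
theorem finrank_antiSpan_sigmaType_eq_of_equivariant (hI : ∀ k, k = i₀ ∨ k = i₁)
    (L : (E i₁ → ℚ) →ₗ[ℚ] (E i₀ → ℚ))
    (hL : ∀ (g : G) (f : E i₁ → ℚ), L (fun y => f (g • y)) = fun z => L f (g • z)) {c : ℚ} (hc : c ≠ 0)
    (hLu : L (antiVec (Φ i₁) (1 : G)) = c • antiVec (Φ i₀) (1 : G)) :
    Module.finrank ℚ (antiSpan G (sigmaType Φ)) = Module.finrank ℚ (antiSpan G (Φ i₁)) := by
  classical
  set M := antiSpan G (sigmaType Φ) with hM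
  set r₀ : ((Σ k, E k) → ℚ) →ₗ[ℚ] (E i₀ → ℚ) := LinearMap.funLeft ℚ ℚ (Sigma.mk i₀) with hr₀
  set r₁ : ((Σ k, E k) → ℚ) →ₗ[ℚ] (E i₁ → ℚ) := LinearMap.funLeft ℚ ℚ (Sigma.mk i₁) with hr₁
  -- on generators: the `i₀`-part is `c⁻¹ L` of the `i₁`-part
  have hgen : ∀ g : G, r₀ (antiVec (sigmaType Φ) g) = c⁻¹ • L (r₁ (antiVec (sigmaType Φ) g)) := by
    intro g
    have h1 : r₁ (antiVec (sigmaType Φ) g) = fun y => antiVec (Φ i₁) (1 : G) (g • y) := by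
      funext y
      rw [hr₁, LinearMap.funLeft_apply, antiVec_sigmaType, antiVec_apply_smul, one_mul]
    rw [h1, hL, hLu]
    funext z
    simp only [hr₀, LinearMap.funLeft_apply, antiVec_sigmaType, Pi.smul_apply, smul_eq_mul]
    rw [antiVec_apply_smul, one_mul, ← mul_assoc, inv_mul_cancel₀ hc, one_mul]
  -- hence on all of `U(Σ)`
  have hker : M ≤ LinearMap.ker (r₀ - c⁻¹ • (L ∘ₗ r₁)) := by
    rw [hM, antiSpan]
    refine Submodule.span_le.2 ?_
    rintro _ ⟨g, rfl⟩
    rw [SetLike.mem_coe, LinearMap.mem_ker, LinearMap.sub_apply, LinearMap.smul_apply, LinearMap.comp_apply,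
      sub_eq_zero]
    exact hgen g
  -- the `i₁`-restriction is injective on `U(Σ)`
  have hinj : Function.Injective (r₁ ∘ₗ M.subtype) := by
    rw [← LinearMap.ker_eq_bot, LinearMap.ker_eq_bot']
    rintro ⟨m, hm⟩ hm0
    rw [LinearMap.comp_apply, Submodule.subtype_apply] at hm0
    apply Subtype.ext
    funext w
    obtain ⟨k, s⟩ := w
    have h0 : r₀ m = 0 := by
      have h1 := hker hm
      rw [LinearMap.mem_ker, LinearMap.sub_apply, LinearMap.smul_apply, LinearMap.comp_apply, sub_eq_zero] at h1
      rw [h1, hm0, map_zero, smul_zero]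
    rcases hI k with rfl | rfl
    · exact congrFun h0 s
    · exact congrFun hm0 s
  have hrange : LinearMap.range (r₁ ∘ₗ M.subtype) = antiSpan G (Φ i₁) := by
    rw [LinearMap.range_comp, Submodule.range_subtype, hr₁, hM, map_funLeft_mk_antiSpan_sigmaType]
  rw [← hrange]
  exact (LinearMap.finrank_range_of_inj hinj).symm

/-- **`rank(Σ) = rank(Φ_{i₁})`** under the hypothesis of `finrank_antiSpan_sigmaType_eq_of_equivariant`.
[cite: Gordon1999HodgeAVSurvey, 7.5–7.7] [cite: Shimura1998, §32.10] -/
theorem typeRank_sigmaType_eq_of_equivariant [Fintype I] [Nonempty (E i₁)] (h : ∀ i, IsCMTypeWith ρ (Φ i))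
    (hI : ∀ k, k = i₀ ∨ k = i₁) (L : (E i₁ → ℚ) →ₗ[ℚ] (E i₀ → ℚ))
    (hL : ∀ (g : G) (f : E i₁ → ℚ), L (fun y => f (g • y)) = fun z => L f (g • z)) {c : ℚ} (hc : c ≠ 0)
    (hLu : L (antiVec (Φ i₁) (1 : G)) = c • antiVec (Φ i₀) (1 : G)) :
    typeRank G (sigmaType Φ) = typeRank G (Φ i₁) := by
  haveI : Nonempty (Σ k, E k) := ⟨⟨i₁, Classical.arbitrary _⟩⟩
  rw [(IsCMTypeWith.sigmaType h).typeRank_eq_finrank_antiSpan_add_one, (h i₁).typeRank_eq_finrank_antiSpan_add_one,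
    finrank_antiSpan_sigmaType_eq_of_equivariant hI L hL hc hLu]

/-- **The family is DEGENERATE** under the hypothesis of `finrank_antiSpan_sigmaType_eq_of_equivariant` (as soon as
the slot `i₀` is inhabited): `rank(Σ) = rank(Φ_{i₁}) ≤ |E_{i₁}|/2 + 1 < |E_{i₀} ⊔ E_{i₁}|/2 + 1`.
[cite: Gordon1999HodgeAVSurvey, 7.5–7.7] -/
theorem typeRank_sigmaType_lt_of_equivariant [Fintype I] [Nonempty (E i₀)] [Nonempty (E i₁)]
    (h : ∀ i, IsCMTypeWith ρ (Φ i)) (h01 : i₀ ≠ i₁) (hI : ∀ k, k = i₀ ∨ k = i₁)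
    (L : (E i₁ → ℚ) →ₗ[ℚ] (E i₀ → ℚ))
    (hL : ∀ (g : G) (f : E i₁ → ℚ), L (fun y => f (g • y)) = fun z => L f (g • z)) {c : ℚ} (hc : c ≠ 0)
    (hLu : L (antiVec (Φ i₁) (1 : G)) = c • antiVec (Φ i₀) (1 : G)) :
    typeRank G (sigmaType Φ) < Fintype.card (Σ k, E k) / 2 + 1 := by
  rw [typeRank_sigmaType_eq_of_equivariant h hI L hL hc hLu, card_sigma_div_two h]
  have hle := (h i₁).typeRank_le
  have h2 : 2 ≤ Fintype.card (E i₀) := by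
    obtain ⟨z⟩ := ‹Nonempty (E i₀)›
    exact Fintype.one_lt_card_iff_nontrivial.2 ⟨⟨ρ • z, z, (h i₀).rho_smul_ne z⟩⟩
  have hsum : Fintype.card (E i₀) / 2 + Fintype.card (E i₁) / 2 ≤ ∑ k, Fintype.card (E k) / 2 := by
    rw [Fintype.sum_eq_add i₀ i₁ h01 (fun k hk => by
      rcases hI k with rfl | rfl
      · exact absurd rfl hk.1
      · exact absurd rfl hk.2)]
  omega

/-! ### §2 Incidence sums are equivariant -/

/-- **Incidence sums of a `G`-invariant relation are equivariant**: for `R(gz, gy) ⟺ R(z, y)` and the linear map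
`(L f)(z) = Σ_{y : R(z, y)} f(y)` (written through an indicator matrix), `L(f ∘ g) = (L f) ∘ g`.  [folklore] -/
theorem incidenceSum_comp_smul {X W : Type*} [MulAction G X] [MulAction G W] [Fintype W]
    (A : X → W → ℚ) (hA : ∀ (g : G) (z : X) (y : W), A (g • z) (g • y) = A z y) (g : G) (f : W → ℚ) (z : X) :
    ∑ y, A z y * f (g • y) = ∑ y, A (g • z) y * f y := by
  refine Fintype.sum_equiv (MulAction.toPerm g) _ _ fun y => ?_
  rw [MulAction.toPerm_apply, hA]

/-- The same for the linear map `Matrix.toLin'` of the indicator matrix: `L(f ∘ g) = (L f) ∘ g`. [folklore] -/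
theorem toLin'_comp_smul {X W : Type*} [MulAction G X] [MulAction G W] [Fintype X] [Fintype W] [DecidableEq X]
    [DecidableEq W] (A : Matrix X W ℚ) (hA : ∀ (g : G) (z : X) (y : W), A (g • z) (g • y) = A z y) (g : G)
    (f : W → ℚ) : Matrix.toLin' A (fun y => f (g • y)) = fun z => Matrix.toLin' A f (g • z) := by
  funext z
  rw [Matrix.toLin'_apply, Matrix.toLin'_apply, Matrix.mulVec, Matrix.mulVec, dotProduct, dotProduct]
  exact incidenceSum_comp_smul A hA g f z

end ReflexSlot

end Summit.HodgeConjecture.CorCM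

end
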